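import Mathlib
import Summits.NavierStokesRegularity.NavierStokesRegularity.Theorems.FilamentSkeletonRssAnalyticStripLiaSymbolNumericsDefs
import Summits.NavierStokesRegularity.NavierStokesRegularity.Theorems.FilamentSkeletonRssAnalyticStripLiaSymbolRep

/-!
# The partner kernel's cosine symbol (`TangentSkeletonNearStraightL`, stmt-NavierStokesRegularity-23320; linear heart,
# strategist's cut D5 (R♯-sw) of `Cruxes/SkeletonJ1L/STRATEGY-CENSUS.md` PART III)

The inter-filament (partner) block of the linearised tangency operator of a near-straight skeleton couples two filaments at
distance `d` through the matched Rosenhead–Moore kernel `((d² + σ²) + μ²)^{-3/2}` (`μ²` the matched core constant times the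
core area).  Its Fourier symbol in arclength is the classical cosine transform
  `∫_ℝ cos(kσ)·(σ² + D²)^{−3/2} dσ = 2|k|·K₁(|k|D)/D`,   `D² = d² + μ²`.
Mathlib has no `K_ν`; the tree's vocabulary for `x·K₁(x)` is `Numerics.Cint (x²/4)`, `Cint p = ∫₀^∞ e^{−t}e^{−p/t} dt`
(`…AnalyticStripLiaSymbolNumericsDefs`, the `C` of the local-induction symbol files).  This file proves, def-free:

* `integral_cos_mul_inv_rpow_three_halves` : `∫_ℝ cos(xh)(1+h²)^{−3/2} dh = 2·Cint(x²/4)` — Γ(3/2)-subordination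
  `(1+h²)^{-3/2} = Γ(3/2)⁻¹∫₀^∞ √t e^{−(1+h²)t}dt` (`…LiaSymbolRep.inv_rpow_three_halves_eq_integral`), Fubini, and the Gaussian
  cosine integral (`…LiaSymbolRep.integral_cos_mul_exp_neg_mul_sq`);
* `integral_cos_mul_inv_rpow_three_halves_scale` : `∫_ℝ cos(kσ)(σ²+D²)^{−3/2} dσ = (2/D²)·Cint(k²D²/4)` for `D > 0`.

The exponential bound (the swirl-band decoupling itself) is assembled in `…TangentSkeletonNearStraightLSwirlBandDecoupling`
from the sharp Laplace bound `Cint p ≤ (1+2√p)e^{−2√p}` of `…TangentSkeletonNearStraightLBesselSharp`.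
HONEST FRAMING: a lemma about explicit real integrals, serving the LINEAR THEORY of a HYPOTHETICAL filament skeleton on the
NEGATIVE side of a MODEL route; it proves no registered stub, and nothing here bears on Navier–Stokes regularity or blow-up.
`--supports stmt-NavierStokesRegularity-23320`.
-/

set_option linter.dupNamespace false

noncomputable section

open Real Set MeasureTheory Filter Topology

namespace Summit.NavierStokesRegularity.NavierStokesRegularity.Theorems.TangentSkeletonNearStraightLSwirlBand

open Summit.NavierStokesRegularity.NavierStokesRegularity.Theorems.AnalyticStripLiaSymbol
open Summit.NavierStokesRegularity.NavierStokesRegularity.Theorems.AnalyticStripLiaSymbol.Numerics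

/-! ## §1  The cosine transform of `(1+h²)^{-3/2}` -/

/-- Continuity of the subordinated two-variable integrand `cos(xh)·Γ(3/2)⁻¹·t^{1/2}e^{−(1+h²)t}`. [folklore] -/
theorem continuous_cosSubordinand (x : ℝ) : Continuous (fun p : ℝ × ℝ => Real.cos (x * p.1)
    * ((Real.Gamma (3 / 2))⁻¹ * (p.2 ^ (1 / 2 : ℝ) * Real.exp (-((1 + p.1 ^ 2) * p.2))))) := by
  have hr : Continuous fun p : ℝ × ℝ => p.2 ^ (1 / 2 : ℝ) :=
    (Real.continuous_rpow_const (by norm_num)).comp continuous_snd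
  fun_prop

/-- Integrability of the subordinated cosine integrand on `ℝ × (0,∞)` (the `t`-integral of the norm is
`|cos(xh)|·(1+h²)^{−3/2} ≤ (1+h²)⁻¹`). [folklore] -/
theorem integrable_cosSubordinand (x : ℝ) :
    Integrable (fun p : ℝ × ℝ => Real.cos (x * p.1)
      * ((Real.Gamma (3 / 2))⁻¹ * (p.2 ^ (1 / 2 : ℝ) * Real.exp (-((1 + p.1 ^ 2) * p.2)))))
      ((volume : Measure ℝ).prod (volume.restrict (Ioi (0:ℝ)))) := by
  have hmeas : AEStronglyMeasurable (fun p : ℝ × ℝ => Real.cos (x * p.1)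
      * ((Real.Gamma (3 / 2))⁻¹ * (p.2 ^ (1 / 2 : ℝ) * Real.exp (-((1 + p.1 ^ 2) * p.2)))))
      ((volume : Measure ℝ).prod (volume.restrict (Ioi (0:ℝ)))) :=
    (continuous_cosSubordinand x).aestronglyMeasurable
  rw [integrable_prod_iff hmeas]
  constructor
  · refine Filter.Eventually.of_forall fun h => ?_
    exact ((integrableOn_rpow_half_mul_exp h).const_mul ((Real.Gamma (3 / 2))⁻¹)).const_mul (Real.cos (x * h))
  · have hnorm : ∀ h : ℝ, ∫ t in Ioi (0:ℝ), ‖(fun p : ℝ × ℝ => Real.cos (x * p.1)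
      * ((Real.Gamma (3 / 2))⁻¹ * (p.2 ^ (1 / 2 : ℝ) * Real.exp (-((1 + p.1 ^ 2) * p.2))))) (h, t)‖
        = |Real.cos (x * h)| * ((1 + h ^ 2) ^ (3 / 2 : ℝ))⁻¹ := by
      intro h
      have hG : 0 < (Real.Gamma (3 / 2))⁻¹ := inv_pos.mpr (Real.Gamma_pos_of_pos (by norm_num))
      have hpt : ∀ t ∈ Ioi (0:ℝ), ‖(fun p : ℝ × ℝ => Real.cos (x * p.1)
          * ((Real.Gamma (3 / 2))⁻¹ * (p.2 ^ (1 / 2 : ℝ) * Real.exp (-((1 + p.1 ^ 2) * p.2))))) (h, t)‖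
            = |Real.cos (x * h)| * ((Real.Gamma (3 / 2))⁻¹ * (t ^ (1 / 2 : ℝ) * Real.exp (-((1 + h ^ 2) * t)))) := by
        intro t ht
        simp only [Real.norm_eq_abs, abs_mul]
        rw [abs_of_pos hG, abs_of_nonneg (Real.rpow_nonneg (le_of_lt ht) _), abs_of_pos (Real.exp_pos _)]
      rw [setIntegral_congr_fun measurableSet_Ioi hpt, integral_const_mul, integral_const_mul,
        inv_rpow_three_halves_eq_integral h]
    simp_rw [hnorm]
    have hdom : Integrable (fun h : ℝ => (1 + h ^ 2)⁻¹) (volume : Measure ℝ) := integrable_inv_one_add_sq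
    refine hdom.mono' ?_ ?_
    · refine ((Continuous.abs ?_).mul ?_).aestronglyMeasurable
      · exact Real.continuous_cos.comp (continuous_const.mul continuous_id)
      · refine Continuous.inv₀ ?_ (fun h => (Real.rpow_pos_of_pos (by positivity) _).ne')
        exact (continuous_const.add (continuous_pow 2)).rpow_const fun _ => Or.inr (by norm_num)
    · refine Filter.Eventually.of_forall fun h => ?_
      have hpos : 0 < 1 + h ^ 2 := by positivity
      have h1 : 1 ≤ 1 + h ^ 2 := by nlinarith
      rw [Real.norm_eq_abs, abs_mul, abs_abs, abs_of_pos (inv_pos.mpr (Real.rpow_pos_of_pos hpos _))]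
      have hc : |Real.cos (x * h)| ≤ 1 := Real.abs_cos_le_one _
      -- (1+h²)^{3/2} ≥ (1+h²)
      have hpow : 1 + h ^ 2 ≤ (1 + h ^ 2) ^ (3 / 2 : ℝ) := by
        have := Real.rpow_le_rpow_of_exponent_le h1 (show (1:ℝ) ≤ 3 / 2 by norm_num)
        rwa [Real.rpow_one] at this
      have hinv : ((1 + h ^ 2) ^ (3 / 2 : ℝ))⁻¹ ≤ (1 + h ^ 2)⁻¹ := inv_anti₀ hpos hpow
      calc |Real.cos (x * h)| * ((1 + h ^ 2) ^ (3 / 2 : ℝ))⁻¹ ≤ 1 * (1 + h ^ 2)⁻¹ := by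
            gcongr
        _ = (1 + h ^ 2)⁻¹ := one_mul _

/-- For `t > 0`: `Γ(3/2)⁻¹·t^{1/2}·e^{−t}·√(π/t)·e^{−x²/(4t)} = 2·e^{−t}e^{−(x²/4)/t}`. [folklore] -/
theorem subordination_weight_eq {t : ℝ} (ht : 0 < t) (x : ℝ) :
    (Real.Gamma (3 / 2))⁻¹ * (t ^ (1 / 2 : ℝ) * Real.exp (-t)) * (√(π / t) * Real.exp (-x ^ 2 / (4 * t)))
      = 2 * (Real.exp (-t) * Real.exp (-((x ^ 2 / 4) / t))) := by
  rw [Gamma_three_halves]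
  have hsq : t ^ (1 / 2 : ℝ) = √t := by rw [Real.sqrt_eq_rpow]
  have hpi : 0 < π := Real.pi_pos
  have h1 : √(π / t) = √π / √t := Real.sqrt_div (le_of_lt hpi) t
  have hst : 0 < √t := Real.sqrt_pos.mpr ht
  have hsp : 0 < √π := Real.sqrt_pos.mpr hpi
  have hx : -x ^ 2 / (4 * t) = -((x ^ 2 / 4) / t) := by field_simp
  rw [hsq, h1, hx]
  field_simp

/-- **Cosine transform of `(1+h²)^{-3/2}`**: `∫_ℝ cos(xh)·(1+h²)^{−3/2} dh = 2·C(x²/4)` where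
`C(p) = ∫₀^∞ e^{−t}e^{−p/t} dt = 2√p·K₁(2√p)` is the tree's `Numerics.Cint` — i.e. the classical `x·K₁(x)` on each
half-line.  Proof: Γ(3/2)-subordination, Fubini, Gaussian cosine integral. [folklore; Watson, Bessel Functions §6.16] -/
theorem integral_cos_mul_inv_rpow_three_halves (x : ℝ) :
    ∫ h : ℝ, Real.cos (x * h) * ((1 + h ^ 2) ^ (3 / 2 : ℝ))⁻¹ = 2 * Cint (x ^ 2 / 4) := by
  have hL : ∫ h : ℝ, Real.cos (x * h) * ((1 + h ^ 2) ^ (3 / 2 : ℝ))⁻¹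
      = ∫ h : ℝ, ∫ t in Ioi (0:ℝ), (fun p : ℝ × ℝ => Real.cos (x * p.1)
          * ((Real.Gamma (3 / 2))⁻¹ * (p.2 ^ (1 / 2 : ℝ) * Real.exp (-((1 + p.1 ^ 2) * p.2))))) (h, t) := by
    refine integral_congr_ae (Filter.Eventually.of_forall fun h => ?_)
    simp only []
    rw [integral_const_mul, integral_const_mul, inv_rpow_three_halves_eq_integral h]
  have hint : Integrable (Function.uncurry fun h t => (fun p : ℝ × ℝ => Real.cos (x * p.1)
      * ((Real.Gamma (3 / 2))⁻¹ * (p.2 ^ (1 / 2 : ℝ) * Real.exp (-((1 + p.1 ^ 2) * p.2))))) (h, t))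
      ((volume : Measure ℝ).prod (volume.restrict (Ioi (0:ℝ)))) := integrable_cosSubordinand x
  have hswap := integral_integral_swap hint
  rw [hL, hswap]
  -- inner `h`-integral: Gaussian cosine integral
  have hinner : ∀ t ∈ Ioi (0:ℝ), (∫ h : ℝ, (fun p : ℝ × ℝ => Real.cos (x * p.1)
      * ((Real.Gamma (3 / 2))⁻¹ * (p.2 ^ (1 / 2 : ℝ) * Real.exp (-((1 + p.1 ^ 2) * p.2))))) (h, t))
        = 2 * (Real.exp (-t) * Real.exp (-((x ^ 2 / 4) / t))) := by
    intro t ht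
    have ht : (0:ℝ) < t := ht
    have hrw : ∀ h : ℝ, (fun p : ℝ × ℝ => Real.cos (x * p.1)
        * ((Real.Gamma (3 / 2))⁻¹ * (p.2 ^ (1 / 2 : ℝ) * Real.exp (-((1 + p.1 ^ 2) * p.2))))) (h, t)
          = ((Real.Gamma (3 / 2))⁻¹ * (t ^ (1 / 2 : ℝ) * Real.exp (-t)))
            * (Real.cos (x * h) * Real.exp (-t * h ^ 2)) := by
      intro h
      simp only []
      have : Real.exp (-((1 + h ^ 2) * t)) = Real.exp (-t) * Real.exp (-t * h ^ 2) := by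
        rw [← Real.exp_add]; congr 1; ring
      rw [this]; ring
    simp_rw [hrw]
    rw [integral_const_mul, integral_cos_mul_exp_neg_mul_sq ht x, subordination_weight_eq ht x]
  rw [setIntegral_congr_fun measurableSet_Ioi hinner, integral_const_mul]
  rfl


/-! ## §2  Scaling to core-plus-distance width `D`: `∫ cos(kσ)(σ²+D²)^{-3/2} dσ = (2/D²)·C(k²D²/4)` -/

/-- `((D h)² + D²)^{3/2} = D³·(1+h²)^{3/2}` for `D > 0`. [folklore] -/
theorem rpow_scale {D : ℝ} (hD : 0 < D) (h : ℝ) :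
    ((D * h) ^ 2 + D ^ 2) ^ (3 / 2 : ℝ) = D ^ 3 * (1 + h ^ 2) ^ (3 / 2 : ℝ) := by
  have h1 : (D * h) ^ 2 + D ^ 2 = D ^ 2 * (1 + h ^ 2) := by ring
  have h2 : (D ^ 2) ^ (3 / 2 : ℝ) = D ^ 3 := by
    rw [← Real.rpow_natCast D 2, ← Real.rpow_mul hD.le, show ((2:ℕ):ℝ) * (3 / 2 : ℝ) = ((3:ℕ):ℝ) by norm_num,
      Real.rpow_natCast]
  rw [h1, Real.mul_rpow (by positivity) (by positivity), h2]

/-- **The partner kernel's cosine symbol**: for `D > 0` and every real `k`,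
`∫_ℝ cos(kσ)·(σ²+D²)^{−3/2} dσ = (2/D²)·C(k²D²/4)` (`= 2|k|·K₁(|k|D)/D`). [folklore] -/
theorem integral_cos_mul_inv_rpow_three_halves_scale {D : ℝ} (hD : 0 < D) (k : ℝ) :
    ∫ σ : ℝ, Real.cos (k * σ) * ((σ ^ 2 + D ^ 2) ^ (3 / 2 : ℝ))⁻¹ = 2 / D ^ 2 * Cint (k ^ 2 * D ^ 2 / 4) := by
  have hsub := MeasureTheory.Measure.integral_comp_mul_left
    (fun σ : ℝ => Real.cos (k * σ) * ((σ ^ 2 + D ^ 2) ^ (3 / 2 : ℝ))⁻¹) D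
  -- `∫ g(Dh) dh = |D⁻¹| ∫ g`
  have hD0 : D ≠ 0 := hD.ne'
  have habs : |D⁻¹| = D⁻¹ := abs_of_pos (inv_pos.mpr hD)
  rw [habs, smul_eq_mul] at hsub
  have hg : ∀ h : ℝ, Real.cos (k * (D * h)) * (((D * h) ^ 2 + D ^ 2) ^ (3 / 2 : ℝ))⁻¹
      = (D ^ 3)⁻¹ * (Real.cos ((k * D) * h) * ((1 + h ^ 2) ^ (3 / 2 : ℝ))⁻¹) := by
    intro h
    rw [rpow_scale hD h, mul_inv, show k * (D * h) = (k * D) * h by ring]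
    ring
  simp_rw [hg] at hsub
  rw [integral_const_mul, integral_cos_mul_inv_rpow_three_halves (k * D)] at hsub
  -- solve for `∫ g`
  have : ∫ σ : ℝ, Real.cos (k * σ) * ((σ ^ 2 + D ^ 2) ^ (3 / 2 : ℝ))⁻¹
      = D * ((D ^ 3)⁻¹ * (2 * Cint ((k * D) ^ 2 / 4))) := by
    rw [hsub]; field_simp
  rw [this, show (k * D) ^ 2 / 4 = k ^ 2 * D ^ 2 / 4 by ring]
  field_simp

end Summit.NavierStokesRegularity.NavierStokesRegularity.Theorems.TangentSkeletonNearStraightLSwirlBand
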